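import Mathlib
import Summits.Ventures.HodgeRepro2.Tier7.Line1.SepDatum
import Summits.Ventures.HodgeRepro2.Tier7.Line1.FDConverse

/-!
# Tier7/Line1/SepOrth — the separating datum violates `OrthDistinct`

The corollary asked for by t7-plan-1 (STATUS l. 15152): the SEPARATING DATUM `datumS` of `Line1/SepDatum.lean`
(t7-L1-p2, p674249 — `C(D)` holds with pairing `1` at `g = 1`, `CommonIrred D` fails) violates the displayed
hypothesis `OrthDistinct` of `Line1/CupProduct.lean` (t7-L1-p1, p662177; the tower hypothesis of t7-L1-p5's
converse `commonIrred_of_conclusion_of_orth`, `Line1/FDConverse.lean` p663419 / p663859). Two proofs: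
* `not_orthDistinct` — against the converse: `OrthDistinct datumS` would give `CommonIrred datumS` from `C(datumS)`,
  which `not_commonIrred` refutes. This closes the loop in the kernel:
  `C(datumS) ∧ ¬ CommonIrred datumS ∧ ¬ OrthDistinct datumS` against `commonIrred_of_conclusion_of_orth`.
* `not_orthDistinct_witness` — the explicit witness in the quantifier of `OrthDistinct`: the two Hecke-irreducible
  subspaces `W = ι(PW 0) = ι(W⁰ ⊗ ℂ²)` and `W' = ι(PW sq) = ι(Wˢ ⊗ ℂ²)` of `H10 * H10` (`heckeIrred_map_PW`,
  `map_PW_le`, SepActH10 p669264), distinct because independent and non-zero (`map_PW_inf`, `map_PW_ne_bot`), carry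
  `a = f^*Ω_s(1) ∈ W` and `b = f^*Ω_s̄(1) ∈ W'` (`prodModS_le`, `prodModSbar_le`) with `L2 a b = 1 ≠ 0`
  (`pairing_one`): two non-isomorphic irreducibles of `H^{1,0} ∧ H^{1,0}` pair non-trivially.
RECORD (crit-2 l. 15157 (i)+(ii), crit-1 l. 15163 RECORD 1): over the ABSTRACT datum the residual `R_CommonIrred`
of LINE L1 is strictly stronger than `C(D)` (this file + SepDatum); on PRINTED data — `OrthDistinct` (Liu 2021 App. D
(D.1) + multiplicity one), which the real `X` satisfies — `CommonIrred D ↔ C(D)` (`commonIrred_iff_conclusion_of_orth`),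
so on the real `X` the residual is the conclusion again: the datum that separates is exactly one the printed facts
exclude. Nothing here is about the real tower; nothing proves or approaches a non-vanishing.
Author: t7-L1-p2 (prover-pub-hodge-repro2-t7-L1-p2-g2-0). §8(d): NO.
-/

namespace Summit.Ventures.HodgeRepro2.Tier7.Line1.Sep

open Summit.Ventures.HodgeRepro2 Summit.Ventures.HodgeRepro2.T6 Summit.Ventures.HodgeRepro2.Tier7

noncomputable section

/-- the wedge `f^*Ω_s` at `g = 1` lies in the irreducible `ι(PW 0) = ι(W⁰ ⊗ ℂ²)` -/
theorem fOmegaS_one_mem : datumS.fOmegaS 1 ∈ (PW 0).map ι :=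
  prodModS_le (Submodule.subset_span (Set.mem_range_self 1))

/-- the wedge `f^*Ω_s̄` at `g = 1` lies in the irreducible `ι(PW sq) = ι(Wˢ ⊗ ℂ²)` -/
theorem fOmegaSbar_one_mem : datumS.fOmegaSbar 1 ∈ (PW sq).map ι :=
  prodModSbar_le (Submodule.subset_span (Set.mem_range_self 1))

/-- the two irreducibles `ι(PW 0)` and `ι(PW sq)` are distinct (independent and non-zero) -/
theorem map_PW_zero_ne_map_PW_sq : (PW 0).map (ι (J := H1C K7)) ≠ (PW sq).map ι := fun h =>
  map_PW_ne_bot 0 Wmod_zero_le_Usub (by rw [← map_PW_inf (J := H1C K7), h, inf_idem])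

/-- **THE SEPARATING DATUM VIOLATES `OrthDistinct` — explicit witness**: the distinct Hecke-irreducibles
`ι(W⁰ ⊗ ℂ²)` and `ι(Wˢ ⊗ ℂ²)` of `H^{1,0} ∧ H^{1,0}` contain `f^*Ω_s(1)` and `f^*Ω_s̄(1)`, whose `L²` pairing is `1`. -/
theorem not_orthDistinct_witness : ¬ Line1.OrthDistinct datumS := fun ho => by
  have h := ho ((PW 0).map ι) ((PW sq).map ι) (heckeIrred_map_PW 0 Wmod_zero_le_Usub)
    (heckeIrred_map_PW sq Wmod_sq_le_Usub) (map_PW_le 0) (map_PW_le sq) map_PW_zero_ne_map_PW_sq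
    _ fOmegaS_one_mem _ fOmegaSbar_one_mem
  rw [pairing_one] at h
  exact one_ne_zero h

/-- **THE SEPARATING DATUM VIOLATES `OrthDistinct`** (plan-1 l. 15152): the displayed hypothesis of
`commonIrred_of_conclusion_of_orth` is exactly what the separating datum violates — `OrthDistinct datumS` together with
`C(datumS)` would give `CommonIrred datumS`, refuted by `not_commonIrred`. On the real `X` it is printed
(Liu 2021 App. D (D.1) + multiplicity one). -/
theorem not_orthDistinct : ¬ Line1.OrthDistinct datumS := fun ho =>
  not_commonIrred (commonIrred_of_conclusion_of_orth datumS ho conclusion_datumS)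

/-- THE LOOP CLOSED IN THE KERNEL: `C(datumS) ∧ ¬ CommonIrred datumS ∧ ¬ OrthDistinct datumS` -/
theorem separating_orth :
    (∃ g : Fin 4 → G, datumS.S.L2 (datumS.fOmegaS g) (datumS.fOmegaSbar g) ≠ 0) ∧
      ¬ Line1.CommonIrred datumS ∧ ¬ Line1.OrthDistinct datumS :=
  ⟨conclusion_datumS, not_commonIrred, not_orthDistinct⟩

end

end Summit.Ventures.HodgeRepro2.Tier7.Line1.Sep
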